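import Summits.BirchSwinnertonDyer.BirchSwinnertonDyer.Theorems.KimAtThreeShallowEqDeepGoodCoreVertexRat
import HarnessLib

/-!
# Route `KimAtThreeKolyvagin` (rung W2), crux `DeepUpperAtThree`: from the vanishing of the
# classical Selmer group AT A LEVEL, `H¹_{𝓚(d)}(ℚ, E[p^{k+1}]) = 0`, to the three END-core vertex
# inputs `hinj` / `hgd` / `hord` of `EndRow.deepUpper_conclusion_of_endCoreInputs`

Cell `bsd-addord`, seat `bsd-addord-w2-c3` (D-0074 row B6), item `stmt-BirchSwinnertonDyer-19076`.
TOOL theorems at one finite level `K = k + 1`, general odd prime `p` (read at `p = 3` by the END row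
file); no definition, no named fact, no `sorry`; nothing asserted about any curve.

WHY.  The END-core input "ONE good core vertex `d`" of `KimAtThreeDeepUpperEndRow` (p425782) is the
triple: `hinj` — `Λ ∘ loc_{v_p}` is injective on `H¹_{𝓕_can(d)}(ℚ, E[p^K])`; `hgd` — the generator's
class `g d` lies in `H¹_{𝓕_can(d)}`; `hord` — `g d` has additive order `p^K`.  This file derives all
three from ONE vanishing statement, `H¹_{𝓚(d)}(ℚ, E[p^K]) = 0` for the classical (Kummer) structure
with the SAME transverse conditions at `d` (the target of the residual core-vertex file
`KimAtThreeDeepUpperCoreVertexKummer` + the cartesian lift), given the witness's kernel clause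
`ker Λ|_{𝓕_can(v_p)} = 𝓚(v_p)` and two END-row inputs already present there (the Poitou–Tate count at
level `d` and [S24] Thm. 4.4 (2) in ORDER form at `d`):
* `hinj` from `H¹_{𝓚(d)} = 0` is seat w2-c4's `localization_injOn_atLevel_of_kummer_atLevel_eq_bot`
  (`KimAtThreeShallowEqDeepGoodCoreVertexRat`, p429019 sequel; imported, not restated);
* `CoreVertexEnd.natCard_selmerGroup_atLevel_le` — then `#H¹_{𝓕_can(d)} ≤ p^K` (it embeds in `ℤ/p^K`);
* `CoreVertexEnd.dualSelmerGroup_atLevel_eq_bot` — with the Poitou–Tate count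
  `#H¹_{𝓕_can(d)} = p^K · #H¹_{𝓕_can(d)^*}` (n1011 `DeepLedger.natCard_selmerGroup_propagated_atLevel_eq`,
  a HYPOTHESIS here in its concluded shape): `H¹_{𝓕_can(d)^*}(ℚ, E[p^K]^D) = 0`, i.e. `d` IS a core
  vertex of `𝓕_can`;
* `CoreVertexEnd.addOrderOf_apply_eq` — with [S24] Thm. 4.4 (2) at `d` in ORDER form
  (`#H^*(d) ∣ p^K → ord(g d) · #H^*(d) = p^K`, the tower family's `hR22′`): `ord (g d) = p^K`;
* **`CoreVertexEnd.vertexInputs_of_kummer_atLevel_eq_bot`** — the triple `(hinj, hgd, hord)` at once.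
[cite: Kim2022StructureSelmer, Prop. 3.12, Thm. 3.13 and §3.4.1 (arXiv p. 17)] [cite: MazurRubin2004, Def. 4.1.8, Prop. 2.3.5]
[cite: Sakamoto2024, Thm. 4.4 (2) (p. 926)] [cite: Rubin2011, Def. 2.1.1 (p. 17)]
-/

set_option autoImplicit false
-- the Theorems namespace of a single-conjunct summit repeats the summit name by design (D-0017)
set_option linter.dupNamespace false

noncomputable section

open scoped Classical NumberField
open Function NumberField IsDedekindDomain WeierstrassCurve
  Summit.BirchSwinnertonDyer.BirchSwinnertonDyer.Theorems.KimAtThreeShallowEqDeepGoodCoreVertex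
  Literature.NumberTheory.EllipticCurves
  Literature.NumberTheory.GaloisRepresentations
  Literature.NumberTheory.GaloisRepresentations.DiscreteGaloisModule Literature.NumberTheory.GaloisCohomology
  Summit.BirchSwinnertonDyer.Rank1Residual.GaloisImage
  Summit.BirchSwinnertonDyer.Rank1Residual.GaloisImage.CoreRankZero

namespace Summit.BirchSwinnertonDyer.BirchSwinnertonDyer.Theorems.KimAtThreeDeepUpperCoreVertexEnd

namespace CoreVertexEnd

variable (W : WeierstrassCurve ℚ) [W.IsElliptic] (p : ℕ) [hp : Fact p.Prime] (k : ℕ)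

/-- **`#H¹_{𝓕_can(d)}(ℚ, E[p^{k+1}]) ≤ p^{k+1}` when `Λ ∘ loc_{v_p}` is injective on it** (it then
embeds in `ℤ/p^{k+1}`). [cite: MazurRubin2004, Def. 4.1.8 (p. 38)] -/
theorem natCard_selmerGroup_atLevel_le {v₀ : HeightOneSpectrum (𝓞 ℚ)}
    (Λ : galoisCohomology ((W.torsionGaloisModule ((p : ℤ) ^ k * (p : ℤ))).toLocal (Sum.inr v₀)) 1
      →+ ZMod (p ^ (k + 1)))
    (D : KolyvaginDatum (W.torsionGaloisModule ((p : ℤ) ^ k * (p : ℤ))))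
    (d : Finset (HeightOneSpectrum (𝓞 ℚ)))
    (hinj : ∀ x ∈ (D.atLevel (propagatedSelmerStructure W p k) d).selmerGroup,
      Λ (galoisCohomology.localization _ (Sum.inr v₀) 1 x) = 0 → x = 0) :
    Nat.card (D.atLevel (propagatedSelmerStructure W p k) d).selmerGroup ≤ p ^ (k + 1) := by
  haveI : NeZero (p ^ (k + 1)) := ⟨pow_ne_zero _ hp.out.ne_zero⟩
  let L : (D.atLevel (propagatedSelmerStructure W p k) d).selmerGroup →+ ZMod (p ^ (k + 1)) :=
    (Λ.comp (galoisCohomology.localization _ (Sum.inr v₀) 1)).comp (AddSubgroup.subtype _)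
  have hL : Injective L := by
    rw [injective_iff_map_eq_zero]
    intro x hx
    exact Subtype.ext (hinj x.1 x.2 hx)
  calc Nat.card (D.atLevel (propagatedSelmerStructure W p k) d).selmerGroup
      ≤ Nat.card (ZMod (p ^ (k + 1))) := Nat.card_le_card_of_injective L hL
    _ = p ^ (k + 1) := Nat.card_zmod _

/-- **`d` is a CORE VERTEX of `𝓕_can`: `H¹_{𝓕_can(d)^*}(ℚ, E[p^{k+1}]^D) = 0`**, from the
injectivity of `Λ ∘ loc_{v_p}` on `H¹_{𝓕_can(d)}` and the Poitou–Tate count at the level,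
`#H¹_{𝓕_can(d)} = p^{k+1} · #H¹_{𝓕_can(d)^*}` (n1011 `DeepLedger.natCard_selmerGroup_propagated_atLevel_eq`,
taken here in its concluded shape `hcount`). [cite: MazurRubin2004, Def. 4.1.8 and Prop. 2.3.5]
[cite: Rubin2011, Exercise 2.1.4 (p. 18)] -/
theorem dualSelmerGroup_atLevel_eq_bot {v₀ : HeightOneSpectrum (𝓞 ℚ)}
    (Λ : galoisCohomology ((W.torsionGaloisModule ((p : ℤ) ^ k * (p : ℤ))).toLocal (Sum.inr v₀)) 1
      →+ ZMod (p ^ (k + 1)))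
    (D : KolyvaginDatum (W.torsionGaloisModule ((p : ℤ) ^ k * (p : ℤ))))
    (d : Finset (HeightOneSpectrum (𝓞 ℚ)))
    (hinj : ∀ x ∈ (D.atLevel (propagatedSelmerStructure W p k) d).selmerGroup,
      Λ (galoisCohomology.localization _ (Sum.inr v₀) 1 x) = 0 → x = 0)
    [Finite (geomTorsion W ((p : ℤ) ^ k * (p : ℤ)))] (inv : LocalInvariants ℚ (p ^ (k + 1)))
    [Finite (inv.dualSelmerStructure (W.torsionGaloisModule ((p : ℤ) ^ k * (p : ℤ)))
      (D.atLevel (propagatedSelmerStructure W p k) d)).selmerGroup]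
    (hcount : Nat.card (D.atLevel (propagatedSelmerStructure W p k) d).selmerGroup =
      p ^ (k + 1) * Nat.card (inv.dualSelmerStructure (W.torsionGaloisModule ((p : ℤ) ^ k * (p : ℤ)))
        (D.atLevel (propagatedSelmerStructure W p k) d)).selmerGroup) :
    (inv.dualSelmerStructure (W.torsionGaloisModule ((p : ℤ) ^ k * (p : ℤ)))
      (D.atLevel (propagatedSelmerStructure W p k) d)).selmerGroup = ⊥ := by
  have hle := natCard_selmerGroup_atLevel_le W p k Λ D d hinj
  rw [hcount] at hle
  have hpos : 0 < p ^ (k + 1) := pow_pos hp.out.pos _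
  have h1 : Nat.card (inv.dualSelmerStructure (W.torsionGaloisModule ((p : ℤ) ^ k * (p : ℤ)))
      (D.atLevel (propagatedSelmerStructure W p k) d)).selmerGroup ≤ 1 :=
    Nat.le_of_mul_le_mul_left (by simpa using hle) hpos
  have hge : 1 ≤ Nat.card (inv.dualSelmerStructure (W.torsionGaloisModule ((p : ℤ) ^ k * (p : ℤ)))
      (D.atLevel (propagatedSelmerStructure W p k) d)).selmerGroup := Nat.card_pos
  exact AddSubgroup.card_eq_one.1 (le_antisymm h1 hge)

/-- **`ord (g d) = p^{k+1}` at such a level**, from [S24] Thm. 4.4 (2) at `d` in ORDER form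
(`#H¹_{𝓕_can(d)^*} ∣ p^{k+1} → ord(g d) · #H¹_{𝓕_can(d)^*} = p^{k+1}`, the clause `hR22′` of the tower
family) and `H¹_{𝓕_can(d)^*} = 0`. [cite: Sakamoto2024, Thm. 4.4 (2) (p. 926)] [cite: MazurRubin2004, Thm. 4.4.1] -/
theorem addOrderOf_apply_eq {v₀ : HeightOneSpectrum (𝓞 ℚ)}
    (Λ : galoisCohomology ((W.torsionGaloisModule ((p : ℤ) ^ k * (p : ℤ))).toLocal (Sum.inr v₀)) 1
      →+ ZMod (p ^ (k + 1)))
    (D : KolyvaginDatum (W.torsionGaloisModule ((p : ℤ) ^ k * (p : ℤ))))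
    (d : Finset (HeightOneSpectrum (𝓞 ℚ)))
    (hinj : ∀ x ∈ (D.atLevel (propagatedSelmerStructure W p k) d).selmerGroup,
      Λ (galoisCohomology.localization _ (Sum.inr v₀) 1 x) = 0 → x = 0)
    [Finite (geomTorsion W ((p : ℤ) ^ k * (p : ℤ)))] (inv : LocalInvariants ℚ (p ^ (k + 1)))
    [Finite (inv.dualSelmerStructure (W.torsionGaloisModule ((p : ℤ) ^ k * (p : ℤ)))
      (D.atLevel (propagatedSelmerStructure W p k) d)).selmerGroup]
    (hcount : Nat.card (D.atLevel (propagatedSelmerStructure W p k) d).selmerGroup =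
      p ^ (k + 1) * Nat.card (inv.dualSelmerStructure (W.torsionGaloisModule ((p : ℤ) ^ k * (p : ℤ)))
        (D.atLevel (propagatedSelmerStructure W p k) d)).selmerGroup)
    (g : Finset (HeightOneSpectrum (𝓞 ℚ)) →
      galoisCohomology (W.torsionGaloisModule ((p : ℤ) ^ k * (p : ℤ))) 1)
    (hR22d : Nat.card (inv.dualSelmerStructure _ (D.atLevel (propagatedSelmerStructure W p k) d)).selmerGroup
        ∣ p ^ (k + 1) →
      addOrderOf (g d) * Nat.card (inv.dualSelmerStructure _
        (D.atLevel (propagatedSelmerStructure W p k) d)).selmerGroup = p ^ (k + 1)) :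
    addOrderOf (g d) = p ^ (k + 1) := by
  have hbot := dualSelmerGroup_atLevel_eq_bot W p k Λ D d hinj inv hcount
  have h1 : Nat.card (inv.dualSelmerStructure (W.torsionGaloisModule ((p : ℤ) ^ k * (p : ℤ)))
      (D.atLevel (propagatedSelmerStructure W p k) d)).selmerGroup = 1 := by
    rw [hbot, AddSubgroup.card_bot]
  have h := hR22d (by rw [h1]; exact one_dvd _)
  rwa [h1, mul_one] at h

/-- **The END-core vertex inputs from ONE vanishing.**  At depth `k` (`K = k + 1`), for the witness's
functional `Λ` at `v_p ∣ p` with its kernel clause `hker` (`ker Λ|_{𝓕_can(v_p)} = 𝓚(v_p)`), a Kolyvagin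
datum `D` on `E[p^K]`, a Kolyvagin system `g ∈ KS(E[p^K], 𝓕_can, D)`, a level `d ∌ v_p` of `D`, the
Poitou–Tate count at `d` (`hcount`) and [S24] Thm. 4.4 (2) at `d` in order form (`hR22d`): if
`H¹_{𝓚(d)}(ℚ, E[p^K]) = 0` then `Λ ∘ loc_{v_p}` is injective on `H¹_{𝓕_can(d)}` (`hinj`), `g d ∈ H¹_{𝓕_can(d)}`
(`hgd`) and `ord (g d) = p^K` (`hord`) — the three vertex binders of
`EndRow.deepUpper_conclusion_of_endCoreInputs` (p425782), verbatim at `p = 3`.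
[cite: Kim2022StructureSelmer, Prop. 3.12 and Thm. 3.13] [cite: Sakamoto2024, Thm. 4.4 (2) (p. 926)]
[cite: MazurRubin2004, Def. 4.1.8 and Thm. 4.4.1] -/
theorem vertexInputs_of_kummer_atLevel_eq_bot (hp2 : p ≠ 2)
    {v₀ : HeightOneSpectrum (𝓞 ℚ)} (hv₀ : ((p : ℕ) : 𝓞 ℚ) ∈ v₀.asIdeal)
    (Λ : galoisCohomology ((W.torsionGaloisModule ((p : ℤ) ^ k * (p : ℤ))).toLocal (Sum.inr v₀)) 1
      →+ ZMod (p ^ (k + 1)))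
    (hker : ∀ x ∈ propagatedSelmerStructure W p k (Sum.inr v₀),
      Λ x = 0 ↔ x ∈ W.kummerSelmerStructure ((p : ℤ) ^ k * (p : ℤ)) (Sum.inr v₀))
    (D : KolyvaginDatum (W.torsionGaloisModule ((p : ℤ) ^ k * (p : ℤ))))
    {g : Finset (HeightOneSpectrum (𝓞 ℚ)) →
      galoisCohomology (W.torsionGaloisModule ((p : ℤ) ^ k * (p : ℤ))) 1}
    (hg : g ∈ D.kolyvaginSystems (propagatedSelmerStructure W p k))
    {d : Finset (HeightOneSpectrum (𝓞 ℚ))} (hd : D.IsLevel d) (hv₀d : v₀ ∉ d)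
    [Finite (geomTorsion W ((p : ℤ) ^ k * (p : ℤ)))] (inv : LocalInvariants ℚ (p ^ (k + 1)))
    [Finite (inv.dualSelmerStructure (W.torsionGaloisModule ((p : ℤ) ^ k * (p : ℤ)))
      (D.atLevel (propagatedSelmerStructure W p k) d)).selmerGroup]
    (hcount : Nat.card (D.atLevel (propagatedSelmerStructure W p k) d).selmerGroup =
      p ^ (k + 1) * Nat.card (inv.dualSelmerStructure (W.torsionGaloisModule ((p : ℤ) ^ k * (p : ℤ)))
        (D.atLevel (propagatedSelmerStructure W p k) d)).selmerGroup)
    (hR22d : Nat.card (inv.dualSelmerStructure _ (D.atLevel (propagatedSelmerStructure W p k) d)).selmerGroup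
        ∣ p ^ (k + 1) →
      addOrderOf (g d) * Nat.card (inv.dualSelmerStructure _
        (D.atLevel (propagatedSelmerStructure W p k) d)).selmerGroup = p ^ (k + 1))
    (hK : (D.atLevel (W.kummerSelmerStructure ((p : ℤ) ^ k * (p : ℤ))) d).selmerGroup = ⊥) :
    (∀ x ∈ (D.atLevel (propagatedSelmerStructure W p k) d).selmerGroup,
        Λ (galoisCohomology.localization _ (Sum.inr v₀) 1 x) = 0 → x = 0) ∧
      g d ∈ (D.atLevel (propagatedSelmerStructure W p k) d).selmerGroup ∧
      addOrderOf (g d) = p ^ (k + 1) := by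
  have hinj := localization_injOn_atLevel_of_kummer_atLevel_eq_bot W p k hp2 hv₀ Λ hker D hv₀d hK
  have hgd : g d ∈ (D.atLevel (propagatedSelmerStructure W p k) d).selmerGroup := by
    rw [KolyvaginDatum.mem_kolyvaginSystems_iff] at hg
    exact hg.mem_selmerGroup d hd
  exact ⟨hinj, hgd, addOrderOf_apply_eq W p k Λ D d hinj inv hcount g hR22d⟩

end CoreVertexEnd

end Summit.BirchSwinnertonDyer.BirchSwinnertonDyer.Theorems.KimAtThreeDeepUpperCoreVertexEnd

end
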